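import Literature.NumberTheory.EllipticCurves.TwoIsogenyDescentIndex
import Literature.NumberTheory.EllipticCurves.SelmerCorankProofs
import Literature.NumberTheory.GaloisRepresentations.ContinuousH1
import Mathlib.FieldTheory.KrullTopology
import Mathlib.FieldTheory.Galois.Infinite
import Mathlib.Topology.Piecewise
import HarnessLib

/-!
# The homogeneous spaces of the descent via `2`-isogeny as classes in `H¹(K, E)`:
# `Ξ : K*/K*² → H¹(K, E)` and the exactness of `E'(K) →α K*/K*² →Ξ H¹(K, E)`
# (Silverman, *AEC*, Thm. X.4.2(a) and Prop. X.4.9)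

Let `K` be a field of characteristic `0`, `E = V : y² = x³ + ax² + bx` an elliptic curve in two-torsion
normal form (`WeierstrassCurve.IsTwoTorsionNF`, `T = (0, 0)`), `φ : E → E' = V.twoIsogenyCodomain` its explicit
`2`-isogeny with kernel `E[φ] = {O, T}` (`IsogenyTwoTorsionProofs.lean`). Since `Γ_K` acts trivially on
`E[φ] ≅ ℤ/2 ≅ μ₂`, `H¹(K, E[φ]) = Hom_cont(Γ_K, ℤ/2) = K*/K*²`, `[d] ↦ χ_d` (the quadratic character cut out by
`√d`), and the map `H¹(K, E[φ]) → H¹(K, E)` of the Kummer sequence of `φ` sends `[d]` to the class `ξ_d` of the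
cocycle `σ ↦ χ_d(σ) · T` — the class in the Weil–Châtelet group `WC(E/K) = H¹(K, E)` of the homogeneous space
`C_d` of the descent (Silverman, *AEC*, X.4.9 and its proof; X.3.6). This file constructs these classes in the
tree's `H¹(K, E) = WeierstrassCurve.galH1` (Mathlib's continuous cohomology of the discrete `Γ_K`-module
`E(K̄) = geomPoints`) and proves the exactness of

  `E'(K) —α→ K*/K*² —Ξ→ H¹(K, E)`,   `α = xSqClass : (X, Y) ↦ [X], T' ↦ [a² - 4b], O ↦ 1`

at `K*/K*²` — Silverman, *AEC*, Thm. X.4.2(a) for the isogeny `φ` ("`0 → E'(K)/φ(E(K)) →δ H¹(G, E[φ]) →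
WC(E/K)[φ] → 0`") together with the computation `δ = α` of Prop. X.4.9 ("`δ(X, Y) = X`, `δ(T') = a² - 4b`";
in Silverman–Tate's letters, §3.5 Prop. 3.8(b): the kernel of `α` on `Γ` is `ψ(Γ̄)`, here in its cohomological
form `ker Ξ = α(E'(K))`):

* `TwoIsogenyTorsor.geomSqrt`, `TwoIsogenyTorsor.galAut_geomSqrt` (`σ √d = ± √d`),
  `isClopen_setOf_galAut_geomSqrt` (Krull topology), `galAut_mul_geomSqrt_iff` (`χ_d` is a character),
  `exists_algebraMap_eq_of_forall_galAut` (Galois descent `K̄^{Γ_K} = K`), `exists_sq_mul_eq_sq_of_twisted`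
  (`ρ √d ∈ K` when `Γ_K` acts on `ρ` through `χ_d`) — general-field forms of the `ℚ`-lemmas of
  `KramerDescentShaGProofs.lean` (`KramerShaG.kramerRoot`, `galEquiv_kramerRoot`, …), which treat Kramer's model;
* `WeierstrassCurve.twoIsogenyTorsorFun/Cocycle/Class` — the continuous cocycle `σ ↦ χ_d(σ) T : Γ_K → E(K̄)` and
  its class `ξ_d ∈ H¹(K, E)`; `two_nsmul_twoIsogenyTorsorClass` (`2 ξ_d = 0`), `twoIsogenyTorsorClass_mul`
  (`ξ_{dd'} = ξ_d + ξ_{d'}`), `twoIsogenyTorsorClass_of_eq_mul_self` (squares die);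
* `WeierstrassCurve.twoIsogenyTorsorHom : Additive (K*/K*²) →+ H¹(K, E)`, `[d] ↦ ξ_d` (`twoIsogenyTorsorHom_sqClass`,
  `two_nsmul_twoIsogenyTorsorHom`);
* **`WeierstrassCurve.twoIsogenyTorsorClass_eq_zero_iff`** — `ξ_d = 0 ↔ [d] ∈ α(E'(K))`. (⇒,
  `sqClass_mem_range_of_twoIsogenyTorsorClass_eq_zero`): a coboundary `χ_d(σ)T = σv - v`, `v ∈ E(K̄)`, yields
  the `Γ_K`-invariant point `φ(v)`, which descends to `P ∈ E'(K)` with `α(P) = [d]` because translation by `T`,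
  `(x, y) ↦ (b/x, -by/x²)`, changes the sign of `y/x` and `x(φ v) = (y/x)²` (the `2`-torsion `v` give `T'` via
  `(2x + a)√d ∈ K`; `v ∈ {O, T}` give squares). (⇐, `twoIsogenyTorsorClass_eq_zero_of_sqClass_mem_range`): for
  `P = (X, Y) ∈ E'(K)` with `X d = w²`, a `φ`-preimage `v ∈ E(K̄)` of `P` (halving, `X = ((w/d)√d)²`) has
  `σv - v ∈ ker φ = {O, T}` (`twoIsogenyGeomHom_smul`, `mem_ker_twoIsogenyGeomHom_iff`), equal to `T` exactly
  when `σ` changes the sign of `y(v)/x(v) = ± (w/d)√d`, i.e. of `√d`; `P = T'` with `(a² - 4b) d = w²` is handled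
  with the `2`-torsion point `((-a + (w/d)√d)/2, 0)`, and `P = O` with a square `d`.

This is the first, field-theoretic, part of the cohomological interpretation of the explicit Selmer sets
`twoIsogenySelmerGroup` of `TwoIsogenySelmerGroup.lean` (whose local conditions are `[d]_v ∈ α(E'(K_v))`,
`TwoIsogenySelmerGroupProofs.lean`): applied over `K = ℚ` it identifies the kernel of `S(a, b) → Ш`, and applied
over the completions it will identify the local conditions with the vanishing of the restrictions of `ξ_d` —
the exact sequence `0 → E'(ℚ)/φ(E(ℚ)) → S^{(φ)}(E/ℚ) → Ш(E/ℚ)[φ] → 0` (*AEC* X.4.2(a)) behind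
`cassels_selmerCorank_two_parity`. Not here: naturality of `ξ_d` under extension of the base field (the local
conditions), the image of `Ξ` (`= ker (φ_* : H¹(K, E) → H¹(K, E'))`, via Kummer theory `kummerMap_surjective`
and `φ(E(K̄)) = E'(K̄)`), and the count `#S(a, b) = #α(E'(ℚ)) · #Ш(E/ℚ)[φ]`.

## References

* J. H. Silverman, *The Arithmetic of Elliptic Curves*, 2nd ed., GTM 106 (2009): X.3 (Thm. X.3.6, `WC(E/K) ≅
  H¹(G, E)`), Thm. X.4.2(a) (the Kummer sequence of an isogeny and `0 → E'(K)/φ(E(K)) → S^{(φ)} → Ш[φ] → 0`),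
  Prop. X.4.9 and its proof (descent via two-isogeny: `E[φ] ≅ μ₂`, `H¹(G, E[φ]) ≅ K*/K*²`, `δ(X, Y) = X`,
  `δ(0,0) = a² - 4b`, the homogeneous spaces `C_d`). [SilvermanAEC2009]
* J. H. Silverman, J. T. Tate, *Rational Points on Elliptic Curves*, 2nd ed. (2015), §3.4 Prop. 3.7, §3.5
  Prop. 3.8(b). [SilvermanTate2015]
* J.-P. Serre, *Galois Cohomology* (1997), I.§2.2, II.§1 (continuous cochains of discrete modules; Kummer theory),
  as formalised in `GaloisRepresentations/ContinuousH1.lean`, `GaloisCohomologyKummerProofs.lean`.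

## Design

* No named facts. Definitions: `geomSqrt`, `galAut` (in the sub-namespace `TwoIsogenyTorsor`, cf.
  `MordellDescent.galAut`), and the cocycle / class / homomorphism as deliberate dot-notation extensions
  `WeierstrassCurve.twoIsogenyTorsor…` (as the sibling files extend `WeierstrassCurve`).
* `K : Type u` in the single universe of `geomPoints`/`galH1` (`ContinuousCohomology.map`); `[CharZero K]` (so
  `K` is perfect and `2 ≠ 0`; the intended `K` are `ℚ` and its completions); `open scoped Classical`.
* Points over `K̄` are handled through their coordinates (`smul_geomPoints_some`), the
  isogeny through the tree's `twoIsogenyGeomHom` (equivariance `twoIsogenyGeomHom_smul`, kernel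
  `mem_ker_twoIsogenyGeomHom_iff`, values `twoIsogenyGeomHom_some`) and, on `K̄`-points of `V.baseChange K̄`,
  `twoIsogenyFun` (halving `exists_twoIsogenyFun_eq`, `twoIsogenyX_mul_sq`, `twoTorsionPoint_add_some`).
-/

noncomputable section

open scoped Classical

universe u

namespace Literature.NumberTheory.EllipticCurves

open Literature.NumberTheory.GaloisRepresentations

/-! ## Square roots in `K̄` and the quadratic characters `χ_d` of `Γ_K` -/

namespace TwoIsogenyTorsor

section GaloisGeneric

variable (K : Type u) [Field K]

/-- An element of `Γ_K` as a `K`-algebra automorphism of `K̄` (`Field.absoluteGaloisGroup K` is by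
definition `K̄ ≃ₐ[K] K̄`; this gives `rw`/`simp` a stable head symbol, cf. `KramerShaG.galEquiv`).
[folklore] -/
def galAut (σ : Field.absoluteGaloisGroup K) : AlgebraicClosure K ≃ₐ[K] AlgebraicClosure K := σ

/-- `galAut` is multiplicative. [folklore] -/
theorem galAut_mul (σ τ : Field.absoluteGaloisGroup K) : galAut K (σ * τ) = galAut K σ * galAut K τ :=
  rfl

/-- A square root of `d ∈ K` in `K̄`. [folklore] -/
def geomSqrt (d : K) : AlgebraicClosure K :=
  Classical.choose (IsAlgClosed.exists_eq_mul_self (algebraMap K (AlgebraicClosure K) d))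

/-- `√d · √d = d`. [folklore] -/
theorem geomSqrt_mul_self (d : K) :
    geomSqrt K d * geomSqrt K d = algebraMap K (AlgebraicClosure K) d :=
  (Classical.choose_spec (IsAlgClosed.exists_eq_mul_self (algebraMap K (AlgebraicClosure K) d))).symm

variable {K}

/-- `√d ≠ 0` for `d ≠ 0`. [folklore] -/
theorem geomSqrt_ne_zero {d : K} (hd : d ≠ 0) : geomSqrt K d ≠ 0 := fun h => by
  have := geomSqrt_mul_self K d
  rw [h, mul_zero] at this
  exact hd ((algebraMap K (AlgebraicClosure K)).injective (by rw [_root_.map_zero]; exact this.symm))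

/-- A Galois automorphism sends `√d` to `±√d`. [folklore] -/
theorem galAut_geomSqrt (d : K) (σ : Field.absoluteGaloisGroup K) :
    galAut K σ (geomSqrt K d) = geomSqrt K d ∨ galAut K σ (geomSqrt K d) = -geomSqrt K d := by
  rw [← mul_self_eq_mul_self_iff, ← map_mul, geomSqrt_mul_self, AlgEquiv.commutes]

/-- The fixing subgroup of `K(√d)` is open in `Γ_K` (Krull topology) and fixes `√d`. [folklore] -/
theorem exists_isOpen_subgroup_fixing_geomSqrt (d : K) :
    ∃ H : Subgroup (Field.absoluteGaloisGroup K), IsOpen (H : Set (Field.absoluteGaloisGroup K)) ∧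
      ∀ τ ∈ H, galAut K τ (geomSqrt K d) = geomSqrt K d := by
  let E : IntermediateField K (AlgebraicClosure K) := IntermediateField.adjoin K {geomSqrt K d}
  haveI : FiniteDimensional K E := IntermediateField.finiteDimensional_adjoin fun z _ =>
    @Algebra.IsIntegral.isIntegral K (AlgebraicClosure K) _ _ (AlgebraicClosure.instAlgebra K) _ z
  refine ⟨E.fixingSubgroup, E.fixingSubgroup_isOpen, fun τ hτ => ?_⟩
  have hτ' : galAut K τ ∈ E.fixingSubgroup := hτ
  rw [IntermediateField.mem_fixingSubgroup_iff] at hτ'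
  exact hτ' _ (IntermediateField.subset_adjoin K _ (Set.mem_singleton _))

/-- The stabiliser of `√d` in `Γ_K` is open. [folklore] -/
theorem isOpen_setOf_galAut_geomSqrt (d : K) :
    IsOpen {σ : Field.absoluteGaloisGroup K | galAut K σ (geomSqrt K d) = geomSqrt K d} := by
  obtain ⟨H, hHopen, hfix⟩ := exists_isOpen_subgroup_fixing_geomSqrt d
  rw [isOpen_iff_mem_nhds]
  intro σ hσ
  have hopen : IsOpen ((fun τ => σ * τ) '' (H : Set (Field.absoluteGaloisGroup K))) :=
    (isOpenMap_mul_left σ) _ hHopen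
  refine Filter.mem_of_superset (hopen.mem_nhds ⟨1, H.one_mem, mul_one σ⟩) ?_
  rintro _ ⟨τ, hτ, rfl⟩
  simp only [Set.mem_setOf_eq] at hσ ⊢
  rw [galAut_mul, AlgEquiv.mul_apply, hfix τ hτ, hσ]

/-- The complement of the stabiliser of `√d` is open as well. [folklore] -/
theorem isOpen_setOf_galAut_geomSqrt_ne (d : K) :
    IsOpen {σ : Field.absoluteGaloisGroup K | ¬ galAut K σ (geomSqrt K d) = geomSqrt K d} := by
  obtain ⟨H, hHopen, hfix⟩ := exists_isOpen_subgroup_fixing_geomSqrt d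
  rw [isOpen_iff_mem_nhds]
  intro σ hσ
  have hopen : IsOpen ((fun τ => σ * τ) '' (H : Set (Field.absoluteGaloisGroup K))) :=
    (isOpenMap_mul_left σ) _ hHopen
  refine Filter.mem_of_superset (hopen.mem_nhds ⟨1, H.one_mem, mul_one σ⟩) ?_
  rintro _ ⟨τ, hτ, rfl⟩
  simp only [Set.mem_setOf_eq] at hσ ⊢
  rw [galAut_mul, AlgEquiv.mul_apply, hfix τ hτ]
  exact hσ

/-- The stabiliser of `√d` is clopen. [folklore] -/
theorem isClopen_setOf_galAut_geomSqrt (d : K) :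
    IsClopen {σ : Field.absoluteGaloisGroup K | galAut K σ (geomSqrt K d) = geomSqrt K d} :=
  ⟨⟨isOpen_setOf_galAut_geomSqrt_ne d⟩, isOpen_setOf_galAut_geomSqrt d⟩

variable [CharZero K]

/-- `√d ≠ -√d` for `d ≠ 0` (characteristic `0`). [folklore] -/
theorem geomSqrt_ne_neg {d : K} (hd : d ≠ 0) : geomSqrt K d ≠ -geomSqrt K d := fun h =>
  geomSqrt_ne_zero hd (by
    have h2 : (2 : AlgebraicClosure K) * geomSqrt K d = 0 := by linear_combination h
    simpa using h2)

/-- **`χ_d` is a character**: `στ` fixes `√d` iff `σ` and `τ` both do or both do not. [folklore] -/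
theorem galAut_mul_geomSqrt_iff {d : K} (hd : d ≠ 0) (σ τ : Field.absoluteGaloisGroup K) :
    galAut K (σ * τ) (geomSqrt K d) = geomSqrt K d ↔
      (galAut K σ (geomSqrt K d) = geomSqrt K d ↔ galAut K τ (geomSqrt K d) = geomSqrt K d) := by
  have hrr := geomSqrt_ne_neg hd
  rw [galAut_mul, AlgEquiv.mul_apply]
  rcases galAut_geomSqrt d σ with hs | hs <;> rcases galAut_geomSqrt d τ with ht | ht
  · rw [ht, hs]
    exact iff_of_true rfl (iff_of_true rfl rfl)
  · rw [ht, map_neg, hs]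
    exact iff_of_false (fun h => hrr h.symm) (fun h => hrr (h.mp rfl).symm)
  · rw [ht, hs]
    exact iff_of_false (fun h => hrr h.symm) (fun h => hrr (h.mpr rfl).symm)
  · rw [ht, map_neg, hs, neg_neg]
    exact iff_of_true rfl Iff.rfl

omit [CharZero K] in
/-- A Galois automorphism moving `√d` sends it to `−√d`. [folklore] -/
theorem galAut_geomSqrt_eq_neg_of_ne {d : K} {σ : Field.absoluteGaloisGroup K}
    (hs : ¬ galAut K σ (geomSqrt K d) = geomSqrt K d) : galAut K σ (geomSqrt K d) = -geomSqrt K d :=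
  (galAut_geomSqrt d σ).resolve_left hs

/-- A Galois automorphism sending `√d` to `−√d` does not fix it (`d ≠ 0`). [folklore] -/
theorem not_fix_of_galAut_geomSqrt_eq_neg {d : K} (hd : d ≠ 0) {σ : Field.absoluteGaloisGroup K}
    (hs : galAut K σ (geomSqrt K d) = -geomSqrt K d) : ¬ galAut K σ (geomSqrt K d) = geomSqrt K d :=
  fun h => geomSqrt_ne_neg hd (h.symm.trans hs)

/-- **Galois descent**: an element of `K̄` fixed by `Γ_K` lies in `K` (`K` perfect, being of
characteristic `0`). [folklore] -/
theorem exists_algebraMap_eq_of_forall_galAut {x : AlgebraicClosure K}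
    (hx : ∀ σ : Field.absoluteGaloisGroup K, galAut K σ x = x) :
    ∃ c : K, algebraMap K (AlgebraicClosure K) c = x := by
  haveI : Algebra.IsAlgebraic K (AlgebraicClosure K) :=
    @IsAlgClosure.isAlgebraic K (AlgebraicClosure K) _ _ (AlgebraicClosure.instAlgebra K) _ inferInstance
  haveI : Algebra.IsSeparable K (AlgebraicClosure K) := Algebra.IsAlgebraic.isSeparable_of_perfectField
  haveI : Normal K (AlgebraicClosure K) :=
    @IsAlgClosure.normal K (AlgebraicClosure K) _ _ (AlgebraicClosure.instAlgebra K) inferInstance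
  haveI : IsGalois K (AlgebraicClosure K) := {}
  exact (InfiniteGalois.mem_range_algebraMap_iff_fixed x).mpr fun σ => hx σ

/-- If every `σ ∈ Γ_K` fixes `√d` then `d` is a square in `K`. [folklore] -/
theorem exists_eq_mul_self_of_forall_fix_geomSqrt {d : K}
    (hfix : ∀ σ : Field.absoluteGaloisGroup K, galAut K σ (geomSqrt K d) = geomSqrt K d) :
    ∃ c : K, d = c * c := by
  obtain ⟨c, hc⟩ := exists_algebraMap_eq_of_forall_galAut hfix
  exact ⟨c, (algebraMap K (AlgebraicClosure K)).injective (by rw [map_mul, hc, geomSqrt_mul_self])⟩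

omit [CharZero K] in
/-- Conversely, if `d = c²` in `K` then every `σ` fixes `√d = ±c`. [folklore] -/
theorem galAut_geomSqrt_of_eq_mul_self {d : K} (c : K) (hc : d = c * c) (σ : Field.absoluteGaloisGroup K) :
    galAut K σ (geomSqrt K d) = geomSqrt K d := by
  have h : geomSqrt K d = algebraMap K _ c ∨ geomSqrt K d = -algebraMap K _ c := by
    rw [← mul_self_eq_mul_self_iff, geomSqrt_mul_self, hc, map_mul]
  rcases h with h | h
  · rw [h, AlgEquiv.commutes]
  · rw [h, map_neg, AlgEquiv.commutes]

/-- `Γ_K`-invariants of the form `ρ √d`: if `σ ρ = ρ` whenever `σ √d = √d` and `σ ρ = -ρ` otherwise,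
then `ρ √d ∈ K`, i.e. `ρ² d` is a square `c²` with `c ∈ K`. [folklore] -/
theorem exists_sq_mul_eq_sq_of_twisted {d : K} {ρ : AlgebraicClosure K}
    (hfix : ∀ σ : Field.absoluteGaloisGroup K, galAut K σ (geomSqrt K d) = geomSqrt K d → galAut K σ ρ = ρ)
    (hmov : ∀ σ : Field.absoluteGaloisGroup K, ¬ galAut K σ (geomSqrt K d) = geomSqrt K d →
      galAut K σ ρ = -ρ) :
    ∃ c : K, algebraMap K (AlgebraicClosure K) c = ρ * geomSqrt K d := by
  refine exists_algebraMap_eq_of_forall_galAut fun σ => ?_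
  rw [map_mul]
  by_cases hs : galAut K σ (geomSqrt K d) = geomSqrt K d
  · rw [hs, hfix σ hs]
  · rw [galAut_geomSqrt_eq_neg_of_ne hs, hmov σ hs]
    ring

end GaloisGeneric

end TwoIsogenyTorsor

end Literature.NumberTheory.EllipticCurves

namespace WeierstrassCurve

open Literature.NumberTheory.EllipticCurves Literature.NumberTheory.EllipticCurves.TwoIsogenyTorsor
open Literature.NumberTheory.GaloisRepresentations
open WeierstrassCurve.Affine (SqUnits sqClass sqClass_mul sqClass_sq sqClass_eq_one_iff sqClass_of_ne_zero)

variable {K : Type u} [Field K] [CharZero K] (V : WeierstrassCurve K) [V.IsTwoTorsionNF] [V.IsElliptic]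

/-! ## The quadratic cocycles `σ ↦ χ_d(σ) · T` with values in `E(K̄)` -/

section Cocycle

omit [CharZero K] [V.IsTwoTorsionNF] [V.IsElliptic] in
/-- The Galois action on an affine geometric point acts on its coordinates. [folklore] -/
theorem smul_geomPoints_some (σ : Field.absoluteGaloisGroup K) {x y : AlgebraicClosure K}
    (h : (V.baseChange (AlgebraicClosure K)).toAffine.Nonsingular x y)
    (h' : (V.baseChange (AlgebraicClosure K)).toAffine.Nonsingular (galAut K σ x) (galAut K σ y)) :
    σ • (show V.geomPoints from .some x y h) = .some (galAut K σ x) (galAut K σ y) h' := by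
  change Affine.Point.map ((galAut K σ : AlgebraicClosure K ≃ₐ[K] AlgebraicClosure K) :
      AlgebraicClosure K →ₐ[K] AlgebraicClosure K) (Affine.Point.some x y h) = _
  rw [Affine.Point.map_some]
  rfl

omit [CharZero K] [V.IsTwoTorsionNF] [V.IsElliptic] in
/-- Nonsingularity is preserved by the Galois action on coordinates. [folklore] -/
theorem nonsingular_galAut (σ : Field.absoluteGaloisGroup K) {x y : AlgebraicClosure K}
    (h : (V.baseChange (AlgebraicClosure K)).toAffine.Nonsingular x y) :
    (V.baseChange (AlgebraicClosure K)).toAffine.Nonsingular (galAut K σ x) (galAut K σ y) :=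
  (V.toAffine.baseChange_nonsingular
    ((galAut K σ : AlgebraicClosure K ≃ₐ[K] AlgebraicClosure K) :
      AlgebraicClosure K →ₐ[K] AlgebraicClosure K).injective ..).mpr h

omit [CharZero K] in
/-- `T = (0, 0) ∈ E(K̄)` is `Γ_K`-invariant (it is rational). [folklore] -/
@[simp]
theorem smul_geomTwoTorsionPoint (σ : Field.absoluteGaloisGroup K) :
    σ • V.geomTwoTorsionPoint = V.geomTwoTorsionPoint := by
  unfold geomTwoTorsionPoint twoTorsionPoint
  rw [V.smul_geomPoints_some σ _ (V.nonsingular_galAut σ (nonsingular_zero_zero _))]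
  congr 1 <;> exact map_zero _

omit [CharZero K] in
/-- `T + T = O` in `E(K̄)`. [folklore] -/
theorem geomTwoTorsionPoint_add_self : V.geomTwoTorsionPoint + V.geomTwoTorsionPoint = 0 :=
  twoTorsionPoint_add_twoTorsionPoint _

/-- The values `σ ↦ χ_d(σ) · T` of the quadratic cocycle attached to `d ∈ K*`: `O` if `σ` fixes
`√d`, `T` otherwise — the image in `E(K̄)` of the Kummer cocycle of `d` under
`K*/K*² = H¹(K, μ₂) = H¹(K, E[φ])`, `E[φ] = {O, T}` (Silverman, *AEC*, X.4.9: for the isogeny with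
kernel `E[φ] = {O, T} ≅ μ₂`, "`H¹(G, E[φ]) ≅ K*/(K*)²`"; X.3.6/X.4.2 for `H¹(G, E[φ]) → WC(E/K)`).
[cite: SilvermanAEC2009, Prop. X.4.9 (proof)] -/
def twoIsogenyTorsorFun (d : K) (σ : Field.absoluteGaloisGroup K) : V.geomPoints :=
  if galAut K σ (geomSqrt K d) = geomSqrt K d then 0 else V.geomTwoTorsionPoint

omit [CharZero K] in
/-- `σ ↦ χ_d(σ) T` is continuous (locally constant). [folklore] -/
theorem continuous_twoIsogenyTorsorFun (d : K) : Continuous (V.twoIsogenyTorsorFun d) := by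
  refine Continuous.if ?_ continuous_const continuous_const
  intro σ hσ
  rw [(isClopen_setOf_galAut_geomSqrt d).frontier_eq] at hσ
  exact absurd hσ (Set.notMem_empty σ)

/-- **The quadratic cocycle** `σ ↦ χ_d(σ) T` as a continuous crossed homomorphism `Γ_K → E(K̄)`
(a homomorphism to `{O, T} ⊆ E(K)`, on which `Γ_K` acts trivially). [cite: SilvermanAEC2009, Prop. X.4.9 (proof)] -/
def twoIsogenyTorsorCocycle {d : K} (hd : d ≠ 0) :
    contOneCocycles (discreteTopRep (Field.absoluteGaloisGroup K) V.geomPoints) :=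
  ⟨⟨V.twoIsogenyTorsorFun d, V.continuous_twoIsogenyTorsorFun d⟩, fun σ τ => by
    change V.twoIsogenyTorsorFun d (σ * τ) = V.twoIsogenyTorsorFun d σ + σ • V.twoIsogenyTorsorFun d τ
    unfold twoIsogenyTorsorFun
    have key := galAut_mul_geomSqrt_iff hd σ τ
    by_cases hs : galAut K σ (geomSqrt K d) = geomSqrt K d <;>
      by_cases ht : galAut K τ (geomSqrt K d) = geomSqrt K d
    · rw [if_pos (key.mpr (iff_of_true hs ht)), if_pos hs, if_pos ht, smul_zero, add_zero]
    · rw [if_neg (fun h => ht ((key.mp h).mp hs)), if_pos hs, if_neg ht, smul_geomTwoTorsionPoint,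
        zero_add]
    · rw [if_neg (fun h => hs ((key.mp h).mpr ht)), if_neg hs, if_pos ht, smul_zero, add_zero]
    · rw [if_pos (key.mpr (iff_of_false hs ht)), if_neg hs, if_neg ht, smul_geomTwoTorsionPoint,
        geomTwoTorsionPoint_add_self]⟩

/-- Values of the quadratic cocycle. [folklore] -/
@[simp]
theorem twoIsogenyTorsorCocycle_apply {d : K} (hd : d ≠ 0) (σ : Field.absoluteGaloisGroup K) :
    (V.twoIsogenyTorsorCocycle hd).1 σ = V.twoIsogenyTorsorFun d σ :=
  rfl

/-- **The torsor class `ξ_d ∈ H¹(K, E)`** of the quadratic cocycle — the image of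
`[d] ∈ K*/K*² = H¹(K, E[φ])` in `H¹(K, E) = WC(E/K)`: the class of the homogeneous space `C_d` of
the descent via the `2`-isogeny `φ` with kernel `{O, T}` (Silverman, *AEC*, X.4.9, proof: the
cocycle `σ ↦ √d^σ/√d ∈ μ₂ ≅ E[φ]`; Thm. X.4.2 and X.3.6: `H¹(G, E[φ]) → WC(E/K)[φ]`).
[cite: SilvermanAEC2009, Prop. X.4.9 and Thm. X.4.2] -/
def twoIsogenyTorsorClass {d : K} (hd : d ≠ 0) : V.galH1 :=
  oneCocycleClass _ (V.twoIsogenyTorsorCocycle hd)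

/-! ### `[d] ↦ ξ_d` is a homomorphism `K*/K*² → H¹(K, E)[2]` -/

/-- The class `ξ_d` only depends on `d`. [folklore] -/
theorem twoIsogenyTorsorClass_congr {d d' : K} (hd : d ≠ 0) (hd' : d' ≠ 0) (h : d = d') :
    V.twoIsogenyTorsorClass hd = V.twoIsogenyTorsorClass hd' := by
  subst h; rfl

/-- `2 ξ_d = 0` (the cocycle takes values in `{O, T} ⊆ E[2]`). [folklore] -/
theorem two_nsmul_twoIsogenyTorsorClass {d : K} (hd : d ≠ 0) : 2 • V.twoIsogenyTorsorClass hd = 0 := by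
  unfold twoIsogenyTorsorClass
  refine nsmul_oneCocycleClass_eq_zero _ 2 fun σ => ?_
  rw [twoIsogenyTorsorCocycle_apply, twoIsogenyTorsorFun]
  split_ifs
  · exact smul_zero _
  · rw [two_nsmul, geomTwoTorsionPoint_add_self]

/-- Squares give the trivial class: `ξ_{c²} = 0` (the cocycle is identically `O`). [folklore] -/
theorem twoIsogenyTorsorClass_of_eq_mul_self {d : K} (hd : d ≠ 0) (c : K) (hc : d = c * c) :
    V.twoIsogenyTorsorClass hd = 0 := by
  rw [twoIsogenyTorsorClass, oneCocycleClass_eq_zero_iff]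
  refine ⟨0, fun σ => ?_⟩
  change V.twoIsogenyTorsorFun d σ = σ • (0 : V.geomPoints) - 0
  rw [smul_zero, sub_zero, twoIsogenyTorsorFun, if_pos (galAut_geomSqrt_of_eq_mul_self c hc σ)]

/-- `√(dd') = ± √d √d'`, so `σ` fixes `√(dd')` iff it fixes both or neither of `√d`, `√d'`. [folklore] -/
theorem galAut_geomSqrt_mul_iff {d d' : K} (hd : d ≠ 0) (hd' : d' ≠ 0) (σ : Field.absoluteGaloisGroup K) :
    galAut K σ (geomSqrt K (d * d')) = geomSqrt K (d * d') ↔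
      (galAut K σ (geomSqrt K d) = geomSqrt K d ↔ galAut K σ (geomSqrt K d') = geomSqrt K d') := by
  have hprod : geomSqrt K (d * d') = geomSqrt K d * geomSqrt K d' ∨
      geomSqrt K (d * d') = -(geomSqrt K d * geomSqrt K d') := by
    rw [← mul_self_eq_mul_self_iff, geomSqrt_mul_self, map_mul, ← geomSqrt_mul_self,
      ← geomSqrt_mul_self]
    ring
  have hr := geomSqrt_ne_neg hd
  have hr' := geomSqrt_ne_neg hd'
  have hrr : geomSqrt K d * geomSqrt K d' ≠ -(geomSqrt K d * geomSqrt K d') := fun h => by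
    have h2 : (2 : AlgebraicClosure K) * (geomSqrt K d * geomSqrt K d') = 0 := by linear_combination h
    simp only [mul_eq_zero, OfNat.ofNat_ne_zero, false_or] at h2
    exact h2.elim (geomSqrt_ne_zero hd) (geomSqrt_ne_zero hd')
  have key : galAut K σ (geomSqrt K (d * d')) = geomSqrt K (d * d') ↔
      galAut K σ (geomSqrt K d * geomSqrt K d') = geomSqrt K d * geomSqrt K d' := by
    rcases hprod with h | h
    · rw [h]
    · rw [h, map_neg, neg_inj]
  rw [key, map_mul]
  rcases galAut_geomSqrt d σ with hs | hs <;> rcases galAut_geomSqrt d' σ with ht | ht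
  · rw [hs, ht]
    exact iff_of_true rfl (iff_of_true rfl rfl)
  · rw [hs, ht, mul_neg]
    exact iff_of_false (fun h => hrr h.symm) (fun h => hr' (h.mp rfl).symm)
  · rw [hs, ht, neg_mul]
    exact iff_of_false (fun h => hrr h.symm) (fun h => hr (h.mpr rfl).symm)
  · rw [hs, ht, neg_mul_neg]
    exact iff_of_true rfl (iff_of_false (fun h => hr h.symm) (fun h => hr' h.symm))

/-- `χ_{dd'} T = χ_d T + χ_{d'} T` pointwise. [folklore] -/
theorem twoIsogenyTorsorFun_mul {d d' : K} (hd : d ≠ 0) (hd' : d' ≠ 0) (σ : Field.absoluteGaloisGroup K) :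
    V.twoIsogenyTorsorFun (d * d') σ = V.twoIsogenyTorsorFun d σ + V.twoIsogenyTorsorFun d' σ := by
  unfold twoIsogenyTorsorFun
  have key := galAut_geomSqrt_mul_iff hd hd' σ
  by_cases hs : galAut K σ (geomSqrt K d) = geomSqrt K d <;>
    by_cases ht : galAut K σ (geomSqrt K d') = geomSqrt K d'
  · rw [if_pos (key.mpr (iff_of_true hs ht)), if_pos hs, if_pos ht, add_zero]
  · rw [if_neg (fun h => ht ((key.mp h).mp hs)), if_pos hs, if_neg ht, zero_add]
  · rw [if_neg (fun h => hs ((key.mp h).mpr ht)), if_neg hs, if_pos ht, add_zero]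
  · rw [if_pos (key.mpr (iff_of_false hs ht)), if_neg hs, if_neg ht, geomTwoTorsionPoint_add_self]

/-- **`ξ_{dd'} = ξ_d + ξ_{d'}`**. [folklore] -/
theorem twoIsogenyTorsorClass_mul {d d' : K} (hd : d ≠ 0) (hd' : d' ≠ 0) :
    V.twoIsogenyTorsorClass (mul_ne_zero hd hd') = V.twoIsogenyTorsorClass hd + V.twoIsogenyTorsorClass hd' := by
  rw [twoIsogenyTorsorClass, twoIsogenyTorsorClass, twoIsogenyTorsorClass, ← oneCocycleClass_add]
  congr 1
  refine Subtype.ext (ContinuousMap.ext fun σ => ?_)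
  exact V.twoIsogenyTorsorFun_mul hd hd' σ

/-- `ξ` on units, multiplicatively. [folklore] -/
def twoIsogenyTorsorUnits : Kˣ →* Multiplicative V.galH1 where
  toFun u := Multiplicative.ofAdd (V.twoIsogenyTorsorClass u.ne_zero)
  map_one' := by
    rw [V.twoIsogenyTorsorClass_of_eq_mul_self (1 : Kˣ).ne_zero 1 (by simp)]
    rfl
  map_mul' u v := by
    rw [← ofAdd_add, ← twoIsogenyTorsorClass_mul]

/-- Values of `twoIsogenyTorsorUnits`. [folklore] -/
theorem twoIsogenyTorsorUnits_apply (u : Kˣ) :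
    V.twoIsogenyTorsorUnits u = Multiplicative.ofAdd (V.twoIsogenyTorsorClass u.ne_zero) :=
  rfl

/-- `ξ` kills squares of `Kˣ`. [folklore] -/
theorem range_powMonoidHom_le_ker_twoIsogenyTorsorUnits :
    (powMonoidHom 2 : Kˣ →* Kˣ).range ≤ V.twoIsogenyTorsorUnits.ker := by
  rintro _ ⟨u, rfl⟩
  rw [MonoidHom.mem_ker, twoIsogenyTorsorUnits_apply,
    V.twoIsogenyTorsorClass_of_eq_mul_self _ (u : K) (by rw [powMonoidHom_apply]; push_cast; ring)]
  rfl

/-- **`Ξ : K*/K*² → H¹(K, E)`, `[d] ↦ ξ_d`** — the map `H¹(K, E[φ]) → H¹(K, E)` (`= WC(E/K)`) of the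
descent via the `2`-isogeny `φ` with kernel `{O, T}` (Silverman, *AEC*, Thm. X.4.2 with X.4.9:
`H¹(G, E[φ]) ≅ K*/(K*)²`). [cite: SilvermanAEC2009, Thm. X.4.2 and Prop. X.4.9] -/
def twoIsogenyTorsorHom : Additive (SqUnits K) →+ V.galH1 :=
  MonoidHom.toAdditiveLeft
    (QuotientGroup.lift _ V.twoIsogenyTorsorUnits V.range_powMonoidHom_le_ker_twoIsogenyTorsorUnits)

/-- `Ξ [d] = ξ_d`. [folklore] -/
theorem twoIsogenyTorsorHom_sqClass {d : K} (hd : d ≠ 0) :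
    V.twoIsogenyTorsorHom (Additive.ofMul (sqClass d)) = V.twoIsogenyTorsorClass hd := by
  rw [sqClass_of_ne_zero hd, twoIsogenyTorsorHom, MonoidHom.coe_toAdditiveLeft]
  rfl

/-- `2 Ξ = 0`. [folklore] -/
theorem two_nsmul_twoIsogenyTorsorHom (x : Additive (SqUnits K)) : 2 • V.twoIsogenyTorsorHom x = 0 := by
  rw [← map_nsmul]
  have h : Additive.toMul x * Additive.toMul x = 1 := Affine.SqUnits.mul_self _
  have h2 : 2 • x = 0 := by
    rw [two_nsmul]
    change Additive.ofMul (Additive.toMul x * Additive.toMul x) = 0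
    rw [h]
    rfl
  rw [h2, map_zero]

end Cocycle

end WeierstrassCurve

namespace WeierstrassCurve

open Literature.NumberTheory.EllipticCurves Literature.NumberTheory.EllipticCurves.TwoIsogenyTorsor
open Literature.NumberTheory.GaloisRepresentations
open WeierstrassCurve.Affine (SqUnits sqClass sqClass_mul sqClass_sq sqClass_eq_one_iff sqClass_of_ne_zero)

variable {K : Type u} [Field K] [CharZero K] (V : WeierstrassCurve K) [V.IsTwoTorsionNF] [V.IsElliptic]

section Kernel

/-- Two non-zero field elements with equal square classes have square product. [folklore] -/
theorem exists_mul_eq_sq_of_sqClass_eq' {F : Type*} [Field F] {a b : F} (ha : a ≠ 0) (hb : b ≠ 0)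
    (h : sqClass a = sqClass b) : ∃ w : F, w ≠ 0 ∧ a * b = w ^ 2 := by
  have h1 : sqClass (a * b) = 1 := by rw [sqClass_mul ha hb, h, Affine.SqUnits.mul_self]
  obtain ⟨w, hw⟩ := (sqClass_eq_one_iff (mul_ne_zero ha hb)).mp h1
  refine ⟨w, fun h0 => ?_, hw⟩
  rw [h0, zero_pow two_ne_zero] at hw
  exact mul_ne_zero ha hb hw

/-- Galois descent for the coordinates of an affine geometric point of `V' = V.twoIsogenyCodomain`
fixed by `Γ_K`: it is the base change of a `K`-point. [folklore] -/
theorem exists_eq_some_algebraMap_of_forall_smul_eq {X Y : AlgebraicClosure K}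
    (hXY : (V.twoIsogenyCodomain.baseChange (AlgebraicClosure K)).toAffine.Nonsingular X Y)
    (hfix : ∀ σ : Field.absoluteGaloisGroup K, galAut K σ X = X ∧ galAut K σ Y = Y) :
    ∃ (x₀ y₀ : K) (_ : V.twoIsogenyCodomain.toAffine.Nonsingular x₀ y₀),
      algebraMap K (AlgebraicClosure K) x₀ = X ∧ algebraMap K (AlgebraicClosure K) y₀ = Y := by
  obtain ⟨x₀, hx₀⟩ := exists_algebraMap_eq_of_forall_galAut fun σ => (hfix σ).1
  obtain ⟨y₀, hy₀⟩ := exists_algebraMap_eq_of_forall_galAut fun σ => (hfix σ).2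
  have hinj : Function.Injective (Algebra.ofId K (AlgebraicClosure K)) :=
    (algebraMap K (AlgebraicClosure K)).injective
  have h1 : (V.twoIsogenyCodomain.baseChange (AlgebraicClosure K)).toAffine.Equation
      (Algebra.ofId K (AlgebraicClosure K) x₀) (Algebra.ofId K (AlgebraicClosure K) y₀) := by
    rw [Algebra.ofId_apply, Algebra.ofId_apply, hx₀, hy₀]; exact hXY.1
  have hE : V.twoIsogenyCodomain.toAffine.Equation x₀ y₀ :=
    (V.twoIsogenyCodomain.toAffine.baseChange_equation hinj x₀ y₀).mp h1
  exact ⟨x₀, y₀, Affine.equation_iff_nonsingular.mp hE, hx₀, hy₀⟩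

/-- **Kernel, first half: classes dying in `H¹(K, E)` come from `E'(K)`** — exactness of
`E'(K) →α K*/K*² → H¹(K, E)` at the classes killed (Silverman, *AEC*, Thm. X.4.2(a) for the
isogeny `φ : E → E'` with kernel `{O, T}`: `0 → E'(K)/φ(E(K)) → H¹(G, E[φ]) → WC(E/K)[φ]`; X.4.9:
the connecting map is `α = δ : (X, Y) ↦ X`, `T' ↦ a² - 4b`). If `ξ_d = 0`, a coboundary
`χ_d(σ) T = σv − v`, `v ∈ E(K̄)`, gives the `K`-rational point `φ(v) ∈ E'(K)` with `α(φ(v)) = [d]`: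
for `v = (x, y)`, `σ(y/x) = χ_d(σ) · y/x` since translation by `T` changes the sign of `y/x`, so
`(y/x) √d ∈ K` and `x(φ v) = (y/x)² ≡ d`; the `2`-torsion `v` give `T'` (`(2x + a)√d ∈ K`,
`(a² - 4b) d ∈ K²`), and `v ∈ {O, T}` give squares. [cite: SilvermanAEC2009, Thm. X.4.2(a) and Prop. X.4.9] -/
theorem sqClass_mem_range_of_twoIsogenyTorsorClass_eq_zero {d : K} (hd : d ≠ 0)
    (h0 : V.twoIsogenyTorsorClass hd = 0) : sqClass d ∈ Set.range V.twoIsogenyCodomain.xSqClass := by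
  set L := AlgebraicClosure K with hL
  have hb : V.a₄ ≠ 0 := a₄_ne_zero V
  have hab : V.a₂ ^ 2 - 4 * V.a₄ ≠ 0 := a₂_sq_sub_ne_zero V
  have haL : (V.baseChange L).a₂ = algebraMap K L V.a₂ := rfl
  have hbL : (V.baseChange L).a₄ = algebraMap K L V.a₄ := rfl
  have hbL0 : (V.baseChange L).a₄ ≠ 0 := a₄_ne_zero _
  -- square classes of non-zero elements with square product agree
  have sqeq : ∀ {a' b' w' : K}, a' ≠ 0 → b' ≠ 0 → a' * b' = w' ^ 2 → sqClass a' = sqClass b' := by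
    intro a' b' w' ha hb h
    have h1 : sqClass a' * sqClass b' = 1 := by rw [← sqClass_mul ha hb, h, sqClass_sq]
    calc sqClass a' = sqClass a' * (sqClass b' * sqClass b') := by
          rw [Affine.SqUnits.mul_self]; exact (Affine.SqUnits.mul_one _).symm
      _ = sqClass a' * sqClass b' * sqClass b' := by rw [mul_assoc]
      _ = sqClass b' := by rw [h1]; exact Affine.SqUnits.one_mul _
  -- the coboundary
  obtain ⟨v, hv⟩ := (oneCocycleClass_eq_zero_iff _ _).mp h0
  have hv' : ∀ σ : Field.absoluteGaloisGroup K, V.twoIsogenyTorsorFun d σ = σ • v - v := hv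
  have hfixv : ∀ σ : Field.absoluteGaloisGroup K, galAut K σ (geomSqrt K d) = geomSqrt K d → σ • v = v := by
    intro σ hs
    have := hv' σ
    rw [twoIsogenyTorsorFun, if_pos hs] at this
    exact (sub_eq_zero.mp this.symm)
  have hmovv : ∀ σ : Field.absoluteGaloisGroup K, ¬ galAut K σ (geomSqrt K d) = geomSqrt K d →
      σ • v = V.geomTwoTorsionPoint + v := by
    intro σ hs
    have := hv' σ
    rw [twoIsogenyTorsorFun, if_neg hs] at this
    exact sub_eq_iff_eq_add.mp this.symm
  -- squares
  have square_case : (∀ σ : Field.absoluteGaloisGroup K, galAut K σ (geomSqrt K d) = geomSqrt K d) →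
      sqClass d ∈ Set.range V.twoIsogenyCodomain.xSqClass := by
    intro hfix
    obtain ⟨c, hc⟩ := exists_eq_mul_self_of_forall_fix_geomSqrt hfix
    refine ⟨0, ?_⟩
    rw [xSqClass_zero, hc, Affine.sqClass_mul_self]
  rcases v with _ | ⟨x, y, hxy⟩
  · -- `v = O`: every `σ` fixes `√d`
    refine square_case fun σ => ?_
    by_contra hs
    have e := hmovv σ hs
    change σ • (0 : V.geomPoints) = V.geomTwoTorsionPoint + 0 at e
    rw [smul_zero, add_zero] at e
    exact geomTwoTorsionPoint_ne_zero V e.symm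
  by_cases hx : x = 0
  · -- `v = T`: again every `σ` fixes `√d`
    have hy := y_eq_zero_of_x_eq_zero _ hxy hx
    subst hx hy
    refine square_case fun σ => ?_
    by_contra hs
    have e := hmovv σ hs
    have eT : (Affine.Point.some 0 0 hxy : V.geomPoints) = V.geomTwoTorsionPoint := rfl
    rw [eT, smul_geomTwoTorsionPoint, geomTwoTorsionPoint_add_self] at e
    exact geomTwoTorsionPoint_ne_zero V e
  -- the main case `v = (x, y)`, `x ≠ 0`
  obtain ⟨h', hT⟩ := twoTorsionPoint_add_some (V.baseChange L) hxy hx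
  have hfix : ∀ σ : Field.absoluteGaloisGroup K, galAut K σ (geomSqrt K d) = geomSqrt K d →
      galAut K σ x = x ∧ galAut K σ y = y := by
    intro σ hs
    have e := hfixv σ hs
    rw [V.smul_geomPoints_some σ hxy (V.nonsingular_galAut σ hxy)] at e
    exact Affine.Point.some.inj e
  have hmov : ∀ σ : Field.absoluteGaloisGroup K, ¬ galAut K σ (geomSqrt K d) = geomSqrt K d →
      galAut K σ x = (V.baseChange L).a₄ / x ∧ galAut K σ y = -((V.baseChange L).a₄ * y) / x ^ 2 := by
    intro σ hs
    have e := hmovv σ hs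
    rw [V.smul_geomPoints_some σ hxy (V.nonsingular_galAut σ hxy)] at e
    change _ = (V.baseChange L).twoTorsionPoint + Affine.Point.some x y hxy at e
    rw [hT] at e
    exact Affine.Point.some.inj e
  have hrel := rel_of_nonsingular (V.baseChange L) hxy
  have haσ : ∀ σ : Field.absoluteGaloisGroup K, galAut K σ (V.baseChange L).a₂ = (V.baseChange L).a₂ :=
    fun σ => AlgEquiv.commutes _ _
  by_cases hy : y = 0
  · -- `v` is a `2`-torsion point `≠ T`: `[d] = [a² - 4b] = α(T')`
    subst hy
    have hroot : x ^ 2 + (V.baseChange L).a₂ * x + (V.baseChange L).a₄ = 0 := by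
      have : x * (x ^ 2 + (V.baseChange L).a₂ * x + (V.baseChange L).a₄) = 0 := by
        linear_combination -hrel
      exact (mul_eq_zero.mp this).resolve_left hx
    set ρ : L := 2 * x + (V.baseChange L).a₂ with hρ
    have hρ2 : ρ ^ 2 = (V.baseChange L).a₂ ^ 2 - 4 * (V.baseChange L).a₄ :=
      ((V.baseChange L).a₂_sq_sub_four_a₄_eq_sq hroot).symm
    have hρfix : ∀ σ : Field.absoluteGaloisGroup K, galAut K σ (geomSqrt K d) = geomSqrt K d →
        galAut K σ ρ = ρ := by
      intro σ hs
      rw [hρ, map_add, map_mul, map_ofNat, (hfix σ hs).1, haσ]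
    have hρmov : ∀ σ : Field.absoluteGaloisGroup K, ¬ galAut K σ (geomSqrt K d) = geomSqrt K d →
        galAut K σ ρ = -ρ := by
      intro σ hs
      have hx' : (V.baseChange L).a₄ / x = -(V.baseChange L).a₂ - x := by
        rw [div_eq_iff hx]; linear_combination hroot
      rw [hρ, map_add, map_mul, map_ofNat, (hmov σ hs).1, haσ, hx']
      ring
    obtain ⟨c, hc⟩ := exists_sq_mul_eq_sq_of_twisted hρfix hρmov
    have hcd : (V.a₂ ^ 2 - 4 * V.a₄) * d = c ^ 2 := by
      apply (algebraMap K L).injective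
      rw [map_pow, hc, mul_pow, hρ2, pow_two (geomSqrt K d), geomSqrt_mul_self, map_mul, map_sub,
        map_mul, map_pow, map_ofNat, ← haL, ← hbL]
    refine ⟨V.twoIsogenyCodomain.twoTorsionPoint, ?_⟩
    rw [twoTorsionPoint, xSqClass_some_of_eq_zero _ rfl, twoIsogenyCodomain_a₄]
    exact sqeq hab hd hcd
  · -- the generic case: `x(φ v) = (y/x)² ≡ d`
    set μ : L := y / x with hμ
    have hμ0 : μ ≠ 0 := div_ne_zero hy hx
    have hμfix : ∀ σ : Field.absoluteGaloisGroup K, galAut K σ (geomSqrt K d) = geomSqrt K d →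
        galAut K σ μ = μ := by
      intro σ hs
      obtain ⟨h1, h2⟩ := hfix σ hs
      rw [hμ, map_div₀, h1, h2]
    have hμmov : ∀ σ : Field.absoluteGaloisGroup K, ¬ galAut K σ (geomSqrt K d) = geomSqrt K d →
        galAut K σ μ = -μ := by
      intro σ hs
      obtain ⟨h1, h2⟩ := hmov σ hs
      rw [hμ, map_div₀, h1, h2]
      field_simp
    obtain ⟨c, hc⟩ := exists_sq_mul_eq_sq_of_twisted hμfix hμmov
    -- the coordinates of `φ(v)` are `Γ_K`-invariant
    have hX : (V.baseChange L).twoIsogenyX x = μ ^ 2 := by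
      rw [hμ, div_pow, eq_div_iff (pow_ne_zero 2 hx)]
      exact twoIsogenyX_mul_sq _ hxy hx
    have hXfix : ∀ σ : Field.absoluteGaloisGroup K,
        galAut K σ ((V.baseChange L).twoIsogenyX x) = (V.baseChange L).twoIsogenyX x := by
      intro σ
      rw [hX, map_pow]
      by_cases hs : galAut K σ (geomSqrt K d) = geomSqrt K d
      · rw [hμfix σ hs]
      · rw [hμmov σ hs, neg_sq]
    have hYfix : ∀ σ : Field.absoluteGaloisGroup K,
        galAut K σ ((V.baseChange L).twoIsogenyY x y) = (V.baseChange L).twoIsogenyY x y := by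
      intro σ
      simp only [twoIsogenyY, map_div₀, map_mul, map_sub, map_pow]
      have hb' : galAut K σ (V.baseChange L).a₄ = (V.baseChange L).a₄ := AlgEquiv.commutes _ _
      rw [hb']
      by_cases hs : galAut K σ (geomSqrt K d) = geomSqrt K d
      · obtain ⟨h1, h2⟩ := hfix σ hs
        rw [h1, h2]
      · obtain ⟨h1, h2⟩ := hmov σ hs
        rw [h1, h2]
        field_simp
        ring
    have hns : (V.twoIsogenyCodomain.baseChange L).toAffine.Nonsingular ((V.baseChange L).twoIsogenyX x)
        ((V.baseChange L).twoIsogenyY x y) := by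
      rw [← twoIsogenyCodomain_baseChange]
      exact nonsingular_twoIsogeny _ hxy.1 hx
    obtain ⟨x₀, y₀, h₀, hx₀, hy₀⟩ :=
      V.exists_eq_some_algebraMap_of_forall_smul_eq hns fun σ => ⟨hXfix σ, hYfix σ⟩
    have hx00 : x₀ ≠ 0 := by
      intro h
      apply pow_ne_zero 2 hμ0
      rw [← hX, ← hx₀, h, _root_.map_zero]
    have hxd : x₀ * d = c ^ 2 := by
      apply (algebraMap K L).injective
      rw [map_mul, map_pow, hx₀, hc, hX, mul_pow, pow_two (geomSqrt K d), geomSqrt_mul_self]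
    refine ⟨.some x₀ y₀ h₀, ?_⟩
    rw [xSqClass_some_of_ne_zero _ hx00]
    exact sqeq hx00 hd hxd

omit [V.IsTwoTorsionNF] [V.IsElliptic] [CharZero K] in
/-- The twisted square root `(w/d) √d` of `X = w²/d`: `Γ_K` acts on it through `χ_d`. [folklore] -/
theorem galAut_twistedRoot {d : K} (w : K) (σ : Field.absoluteGaloisGroup K) :
    galAut K σ (algebraMap K (AlgebraicClosure K) (w / d) * geomSqrt K d) =
      if galAut K σ (geomSqrt K d) = geomSqrt K d then algebraMap K (AlgebraicClosure K) (w / d) * geomSqrt K d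
      else -(algebraMap K (AlgebraicClosure K) (w / d) * geomSqrt K d) := by
  rw [map_mul, AlgEquiv.commutes]
  split_ifs with hs
  · rw [hs]
  · rw [galAut_geomSqrt_eq_neg_of_ne hs, mul_neg]

omit [V.IsTwoTorsionNF] [V.IsElliptic] [CharZero K] in
/-- `((w/d) √d)² = w²/d`. [folklore] -/
theorem twistedRoot_sq {d : K} (hd : d ≠ 0) (w : K) :
    (algebraMap K (AlgebraicClosure K) (w / d) * geomSqrt K d) ^ 2 =
      algebraMap K (AlgebraicClosure K) (w ^ 2 / d) := by
  rw [mul_pow, pow_two (geomSqrt K d), geomSqrt_mul_self, ← map_pow, ← map_mul]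
  congr 1
  field_simp

/-- **Kernel, second half: classes coming from `E'(K)` die in `H¹(K, E)`** (the composite
`E'(K) →α K*/K*² → H¹(K, E)` is zero; Silverman, *AEC*, Thm. X.4.2(a) with X.4.9). If `[d] = α(P)`
for a `K`-point `P` of `E'`, then `ξ_d = 0`: for `P = O`, `d` is a square; for `P = T'`,
`(a² - 4b) d = w²` and `v = (x₁, 0)` with `x₁ = (-a + (w/d)√d)/2` has `σv - v = χ_d(σ) T`; for
`P = (X, Y)` with `X d = w²`, a `φ`-preimage `v` of `P` over `K̄` (halving, `X = ((w/d)√d)²`) has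
`σv - v ∈ ker φ = {O, T}`, equal to `T` exactly when `σ` changes the sign of `y(v)/x(v) = ±(w/d)√d`.
[cite: SilvermanAEC2009, Thm. X.4.2(a) and Prop. X.4.9] -/
theorem twoIsogenyTorsorClass_eq_zero_of_sqClass_mem_range {d : K} (hd : d ≠ 0)
    (h : sqClass d ∈ Set.range V.twoIsogenyCodomain.xSqClass) : V.twoIsogenyTorsorClass hd = 0 := by
  have hab : V.a₂ ^ 2 - 4 * V.a₄ ≠ 0 := a₂_sq_sub_ne_zero V
  have haL : (V.baseChange (AlgebraicClosure K)).a₂ = algebraMap K (AlgebraicClosure K) V.a₂ := rfl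
  have hbL : (V.baseChange (AlgebraicClosure K)).a₄ = algebraMap K (AlgebraicClosure K) V.a₄ := rfl
  have hbL0 : (V.baseChange (AlgebraicClosure K)).a₄ ≠ 0 := a₄_ne_zero _
  have h2L : (2 : AlgebraicClosure K) ≠ 0 := two_ne_zero' (V.baseChange (AlgebraicClosure K))
  have h4 : (4 : AlgebraicClosure K) ≠ 0 := by
    rw [show (4 : AlgebraicClosure K) = 2 * 2 by norm_num]; exact mul_ne_zero h2L h2L
  have hinj : Function.Injective (Algebra.ofId K (AlgebraicClosure K)) :=
    (algebraMap K (AlgebraicClosure K)).injective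
  -- affine points with equal coordinates are equal
  have point_ext : ∀ {W' : WeierstrassCurve (AlgebraicClosure K)} {x y x' y' : AlgebraicClosure K}
      {h : W'.toAffine.Nonsingular x y} {h' : W'.toAffine.Nonsingular x' y'}, x = x' → y = y' →
      (Affine.Point.some x y h : W'.toAffine.Point) = Affine.Point.some x' y' h' := by
    intro W' x y x' y' h h' hx hy
    subst hx; subst hy; rfl
  obtain ⟨P, hP⟩ := h
  rcases P with _ | ⟨X, Y, hXY⟩
  · rw [← Affine.Point.zero_def, xSqClass_zero] at hP
    obtain ⟨c, hc⟩ := (sqClass_eq_one_iff hd).mp hP.symm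
    exact V.twoIsogenyTorsorClass_of_eq_mul_self hd c (by rw [hc]; ring)
  rw [twoIsogenyTorsorClass, oneCocycleClass_eq_zero_iff]
  by_cases hX : X = 0
  · -- `P = T'`: `(a² - 4b) d = w²`
    have hY := y_eq_zero_of_x_eq_zero _ hXY hX
    subst hX hY
    rw [xSqClass_some_of_eq_zero _ rfl, twoIsogenyCodomain_a₄] at hP
    obtain ⟨w, -, hw⟩ := exists_mul_eq_sq_of_sqClass_eq' hab hd hP
    obtain ⟨ρ, hρ⟩ : ∃ ρ : AlgebraicClosure K,
        ρ = algebraMap K (AlgebraicClosure K) (w / d) * geomSqrt K d := ⟨_, rfl⟩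
    have hρ2 : ρ ^ 2 = (V.baseChange (AlgebraicClosure K)).a₂ ^ 2 -
        4 * (V.baseChange (AlgebraicClosure K)).a₄ := by
      rw [hρ, twistedRoot_sq hd, haL, hbL, ← map_pow, ← map_ofNat (algebraMap K (AlgebraicClosure K)) 4,
        ← map_mul, ← map_sub]
      congr 1
      rw [div_eq_iff hd]
      linear_combination -hw
    have hσρ : ∀ σ : Field.absoluteGaloisGroup K, galAut K σ ρ =
        if galAut K σ (geomSqrt K d) = geomSqrt K d then ρ else -ρ := by
      intro σ; rw [hρ]; exact galAut_twistedRoot w σ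
    obtain ⟨x₁, hx₁⟩ : ∃ x₁ : AlgebraicClosure K,
        x₁ = (-(V.baseChange (AlgebraicClosure K)).a₂ + ρ) / 2 := ⟨_, rfl⟩
    have hx₁' : 2 * x₁ = -(V.baseChange (AlgebraicClosure K)).a₂ + ρ := by rw [hx₁]; field_simp
    have hroot : x₁ ^ 2 + (V.baseChange (AlgebraicClosure K)).a₂ * x₁ +
        (V.baseChange (AlgebraicClosure K)).a₄ = 0 := by
      apply mul_left_cancel₀ h4
      linear_combination (2 * x₁ + ρ + (V.baseChange (AlgebraicClosure K)).a₂) * hx₁' + hρ2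
    have hx₁0 : x₁ ≠ 0 := by
      rintro h0
      rw [h0] at hroot
      exact hbL0 (by simpa using hroot)
    have hE : (V.baseChange (AlgebraicClosure K)).toAffine.Equation x₁ 0 := by
      rw [equation_iff_of_isTwoTorsionNF]
      linear_combination (-x₁) * hroot
    have hns : (V.baseChange (AlgebraicClosure K)).toAffine.Nonsingular x₁ 0 :=
      Affine.equation_iff_nonsingular.mp hE
    obtain ⟨h', hT⟩ := twoTorsionPoint_add_some (V.baseChange (AlgebraicClosure K)) hns hx₁0
    have hother : (V.baseChange (AlgebraicClosure K)).a₄ / x₁ =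
        (-(V.baseChange (AlgebraicClosure K)).a₂ + -ρ) / 2 := by
      rw [div_eq_iff hx₁0]
      apply mul_left_cancel₀ h4
      linear_combination ((V.baseChange (AlgebraicClosure K)).a₂ + ρ) * hx₁' + hρ2
    refine ⟨(Affine.Point.some x₁ 0 hns : V.geomPoints), fun σ => ?_⟩
    change V.twoIsogenyTorsorFun d σ = σ • (show V.geomPoints from Affine.Point.some x₁ 0 hns) -
      (show V.geomPoints from Affine.Point.some x₁ 0 hns)
    rw [twoIsogenyTorsorFun, V.smul_geomPoints_some σ hns (V.nonsingular_galAut σ hns), eq_comm]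
    have hσa : galAut K σ (V.baseChange (AlgebraicClosure K)).a₂ = (V.baseChange (AlgebraicClosure K)).a₂ :=
      AlgEquiv.commutes _ _
    by_cases hs : galAut K σ (geomSqrt K d) = geomSqrt K d
    · rw [if_pos hs, sub_eq_zero]
      refine point_ext ?_ (map_zero _)
      rw [hx₁, map_div₀, map_add, map_neg, hσa, map_ofNat, hσρ σ, if_pos hs]
    · rw [if_neg hs, sub_eq_iff_eq_add]
      change _ = (V.baseChange (AlgebraicClosure K)).twoTorsionPoint + Affine.Point.some x₁ 0 hns
      rw [hT]
      refine point_ext ?_ ?_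
      · rw [hother, hx₁, map_div₀, map_add, map_neg, hσa, map_ofNat, hσρ σ, if_neg hs]
      · rw [map_zero, mul_zero, neg_zero, zero_div]
  · -- `P = (X, Y)`, `X ≠ 0`: `X d = w²`
    rw [xSqClass_some_of_ne_zero _ hX] at hP
    obtain ⟨w, -, hw⟩ := exists_mul_eq_sq_of_sqClass_eq' hX hd hP
    obtain ⟨μ₀, hμ₀⟩ : ∃ μ₀ : AlgebraicClosure K,
        μ₀ = algebraMap K (AlgebraicClosure K) (w / d) * geomSqrt K d := ⟨_, rfl⟩
    have hμ₀2 : μ₀ ^ 2 = algebraMap K (AlgebraicClosure K) X := by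
      rw [hμ₀, twistedRoot_sq hd]
      congr 1
      rw [div_eq_iff hd]
      linear_combination -hw
    have hX0L : algebraMap K (AlgebraicClosure K) X ≠ 0 := (map_ne_zero _).mpr hX
    have hμ₀0 : μ₀ ≠ 0 := fun h0 => hX0L (by rw [← hμ₀2, h0, zero_pow two_ne_zero])
    have hσμ₀ : ∀ σ : Field.absoluteGaloisGroup K, galAut K σ μ₀ =
        if galAut K σ (geomSqrt K d) = geomSqrt K d then μ₀ else -μ₀ := by
      intro σ; rw [hμ₀]; exact galAut_twistedRoot w σ
    -- the point `P` over `K̄` and a `φ`-preimage `v`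
    have hQ : (V.baseChange (AlgebraicClosure K)).twoIsogenyCodomain.toAffine.Nonsingular
        (algebraMap K (AlgebraicClosure K) X) (algebraMap K (AlgebraicClosure K) Y) := by
      rw [twoIsogenyCodomain_baseChange]
      exact (V.twoIsogenyCodomain.toAffine.baseChange_nonsingular hinj X Y).mpr hXY
    obtain ⟨v, hv⟩ := exists_twoIsogenyFun_eq (V.baseChange (AlgebraicClosure K)) hQ hμ₀2.symm hμ₀0
    rcases v with _ | ⟨x, y, hxy⟩
    · rw [← Affine.Point.zero_def, twoIsogenyFun_zero] at hv
      exact absurd hv.symm (Affine.Point.some_ne_zero _)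
    have hx : x ≠ 0 := fun hx => by
      rw [twoIsogenyFun_some_of_eq_zero _ hxy hx] at hv
      exact absurd hv.symm (Affine.Point.some_ne_zero _)
    rw [twoIsogenyFun_some _ hxy hx] at hv
    obtain ⟨hXx, hYy⟩ := Affine.Point.some.inj hv
    -- `y/x = ± μ₀`
    obtain ⟨μ, hμ⟩ : ∃ μ : AlgebraicClosure K, μ = y / x := ⟨_, rfl⟩
    have hμ2 : μ ^ 2 = μ₀ ^ 2 := by
      rw [hμ₀2, ← hXx, hμ, div_pow, div_eq_iff (pow_ne_zero 2 hx)]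
      exact (twoIsogenyX_mul_sq _ hxy hx).symm
    have hμ0 : μ ≠ 0 := by
      rw [hμ]; exact div_ne_zero (fun hy => hμ₀0 (by
        rw [hμ, hy, zero_div, zero_pow two_ne_zero] at hμ2
        exact pow_eq_zero_iff two_ne_zero |>.mp hμ2.symm)) hx
    have hσμ : ∀ σ : Field.absoluteGaloisGroup K, galAut K σ μ =
        if galAut K σ (geomSqrt K d) = geomSqrt K d then μ else -μ := by
      intro σ
      rcases sq_eq_sq_iff_eq_or_eq_neg.mp hμ2 with h | h
      · rw [h, hσμ₀ σ]
      · rw [h, map_neg, hσμ₀ σ]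
        split_ifs <;> ring
    -- `σ v - v ∈ ker φ = {O, T}` because `φ(v) = P` is `Γ_K`-invariant
    set vg : V.geomPoints := Affine.Point.some x y hxy with hvg
    obtain ⟨h₁, e₁⟩ := twoIsogenyGeomHom_some V hxy hx
    have hPfix : ∀ σ : Field.absoluteGaloisGroup K,
        σ • V.twoIsogenyGeomHom vg = V.twoIsogenyGeomHom vg := by
      intro σ
      rw [hvg, e₁, V.twoIsogenyCodomain.smul_geomPoints_some σ h₁
        (V.twoIsogenyCodomain.nonsingular_galAut σ h₁)]
      refine point_ext ?_ ?_
      · rw [hXx, AlgEquiv.commutes]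
      · rw [hYy, AlgEquiv.commutes]
    have hker : ∀ σ : Field.absoluteGaloisGroup K,
        σ • vg - vg = 0 ∨ σ • vg - vg = V.geomTwoTorsionPoint := by
      intro σ
      refine (mem_ker_twoIsogenyGeomHom_iff V _).mp ?_
      rw [AddMonoidHom.mem_ker, map_sub, twoIsogenyGeomHom_smul, hPfix, sub_self]
    obtain ⟨h', hT⟩ := twoTorsionPoint_add_some (V.baseChange (AlgebraicClosure K)) hxy hx
    refine ⟨vg, fun σ => ?_⟩
    change V.twoIsogenyTorsorFun d σ = σ • vg - vg
    have e := V.smul_geomPoints_some σ hxy (V.nonsingular_galAut σ hxy)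
    rw [twoIsogenyTorsorFun]
    rcases hker σ with h0 | hT'
    · -- `σ v = v` forces `σ μ = μ`, hence `σ` fixes `√d`
      have h0' := h0
      rw [sub_eq_zero, hvg, e] at h0'
      obtain ⟨h1, h2⟩ := Affine.Point.some.inj h0'
      have hσ : galAut K σ μ = μ := by rw [hμ, map_div₀, h1, h2]
      have hs : galAut K σ (geomSqrt K d) = geomSqrt K d := by
        by_contra hs
        rw [hσμ σ, if_neg hs] at hσ
        exact hμ0 (by
          have : (2 : AlgebraicClosure K) * μ = 0 := by linear_combination -hσ
          simpa using this)
      rw [if_pos hs, h0]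
    · -- `σ v = v + T` forces `σ μ = -μ`, hence `σ` moves `√d`
      have hT'' := hT'
      rw [sub_eq_iff_eq_add, hvg, e] at hT''
      change _ = (V.baseChange (AlgebraicClosure K)).twoTorsionPoint + Affine.Point.some x y hxy at hT''
      rw [hT] at hT''
      obtain ⟨h1, h2⟩ := Affine.Point.some.inj hT''
      have hσ : galAut K σ μ = -μ := by
        rw [hμ, map_div₀, h1, h2]
        field_simp
      have hs : ¬ galAut K σ (geomSqrt K d) = geomSqrt K d := by
        intro hs
        rw [hσμ σ, if_pos hs] at hσ
        exact hμ0 (by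
          have : (2 : AlgebraicClosure K) * μ = 0 := by linear_combination hσ
          simpa using this)
      rw [if_neg hs, hT']

/-- **Exactness of `E'(K) →α K*/K*² →Ξ H¹(K, E)`**: `ξ_d = 0` iff `[d] ∈ α(E'(K))`, `α = xSqClass`
of `E' = V.twoIsogenyCodomain` (`(X, Y) ↦ [X]`, `T' ↦ [a² - 4b]`, `O ↦ 1`) — Silverman, *AEC*,
Thm. X.4.2(a) for the `2`-isogeny `φ : E → E'` with kernel `{O, T}` ("`0 → E'(K)/φ(E(K)) →δ
H¹(G, E[φ]) → WC(E/K)[φ] → 0`", exactness at `H¹(G, E[φ]) = K*/K*²`) with the identification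
`δ = α` of Prop. X.4.9 ("`δ(X, Y) = X`, `δ(0, 0) = a² - 4b`", in Silverman's letters `δ : E'(K) → K*/K*²`
for `φ : E → E'`; here `E = V`, `E' = V.twoIsogenyCodomain`). In Silverman–Tate's language (§3.5
Prop. 3.8(b)) `α(Γ̄)… `: the kernel of `Ξ` on `K*/K*²` is exactly the image of `ᾱ`.
[cite: SilvermanAEC2009, Thm. X.4.2(a) and Prop. X.4.9] -/
theorem twoIsogenyTorsorClass_eq_zero_iff {d : K} (hd : d ≠ 0) :
    V.twoIsogenyTorsorClass hd = 0 ↔ sqClass d ∈ Set.range V.twoIsogenyCodomain.xSqClass :=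
  ⟨V.sqClass_mem_range_of_twoIsogenyTorsorClass_eq_zero hd,
    V.twoIsogenyTorsorClass_eq_zero_of_sqClass_mem_range hd⟩

end Kernel


end WeierstrassCurve
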